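import Summits.BirchSwinnertonDyer.BirchSwinnertonDyer.Theorems.ManinLocalTwoThreePinningKernelRows
import Summits.BirchSwinnertonDyer.BirchSwinnertonDyer.Theorems.ManinLocalTwoThreeBracketSturm
import Literature.NumberTheory.EllipticCurves.HeckeOperatorsProofs
import HarnessLib

/-!
# `a₂ₖ(f) = 0` FROM FINITELY MANY COEFFICIENTS: the `U₂`–Sturm device (level `N` with `2 ∣ N`, any weight)

Cell bsd-f2-manin, route `ManinLocalTwoThree` (crux C2 `ManinOddAtFour`, stmt-BirchSwinnertonDyer-22967; `--supports` helper), LEAD p1 gen 26.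
The `χ₋₄` / `χ±8` squeeze transports of desc g46 (`TwistDefect.abs_maninConstant_eq_one_of_squeeze_{negOne,two}Twist_aligned_level`) take the input
`heven : ∀ n, 2 ∣ n → aₙ(f₀) = 0` for the root form `f₀`.  desc's `EtaParity` supplies it for EVEN-SUPPORTED `η`-quotients (half-shift law); for a root
given only by a table (a Bracket–Sturm-certified newform, a cuspidal `η`-combination with odd `δ`'s — `φ₅₂`, `φ₁₀₄` of `…RootFormFiftyTwo/OneHundredFour`)
this file gives the table criterion: if `2 ∣ N` and `a₂ₙ(f) = 0` for all `n < m` with `⌊k·μ₀(N)/12⌋ < m`, then `a₂ₙ(f) = 0` for ALL `n`.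
PROOF: `U₂ f = heckeT (Γ₀(N)) k 2 f` has `q`-coefficients `aₙ(U₂ f) = a₂ₙ(f)` (`qExpansion_coeff_heckeT_holds`, the `p ∣ N` branch), so it vanishes by
Sturm (`BracketSturm.modularForm_eq_zero_of_coeff_eq_zero`), hence all `a₂ₙ(f) = 0`.
* `heckeT_two_eq_zero_of_coeff_eq_zero`, `cuspCoeff_even_eq_zero_of_coeff_eq_zero` (weight `k`), and the table form `cuspCoeff_even_eq_zero_of_table`
  (integer table `t` with `t[n] = aₙ(f)` for `n < K`, `2m ≤ K + 1`, and `t[2n] = 0` for `n < m` — all decidable).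
HONEST FRAMING: a generic tool (standard axioms); nothing here proves C2/C3, Manin's conjecture or BSD.
[cite: DiamondShurman2005, Prop. 5.2.2(a)] [cite: Sturm1987, Thm. 1]
-/

set_option autoImplicit false
-- lint-debt: the directory name repeats the summit name (sibling precedent `ManinLocalTwoThreeRootFormFiftyTwo.lean`)
set_option linter.dupNamespace false

noncomputable section

open UpperHalfPlane hiding I
open scoped MatrixGroups ModularForm
open ModularForm CongruenceSubgroup PowerSeries
open Literature.NumberTheory.ModularForms
open Literature.NumberTheory.EllipticCurves Literature.NumberTheory.EllipticCurves.ModularForms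

namespace Summit.BirchSwinnertonDyer.BirchSwinnertonDyer.Theorems.ManinLocalTwoThree.EvenCoeffVanishing

open Summit.BirchSwinnertonDyer.BirchSwinnertonDyer.Theorems.ManinLocalTwoThree
open BracketSturm PinningKernel

variable {N : ℕ} [NeZero N] {k : ℤ}

/-- **`U₂ f = 0` from finitely many even coefficients** (`2 ∣ N`): if `a₂ₙ(f) = 0` for all `n < m` with `⌊k·μ₀(N)/12⌋ < m`, then
`heckeT (Γ₀(N)) k 2 f = 0`. [cite: DiamondShurman2005, Prop. 5.2.2(a)] [cite: Sturm1987, Thm. 1] -/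
theorem heckeT_two_eq_zero_of_coeff_eq_zero (h2 : 2 ∣ N) (f : CuspForm (Gamma0 N) k) {m : ℕ} (hm : (k * gamma0Index N).toNat / 12 < m)
    (h : ∀ n < m, cuspCoeff f (2 * n) = 0) : heckeT (Gamma0 N) k 2 f = 0 := by
  have hmf : ModularFormClass.modularForm (heckeT (Gamma0 N) k 2 f) = 0 := by
    refine modularForm_eq_zero_of_coeff_eq_zero _ (m := m) (fun i hi ↦ ?_) hm
    change (qExpansion 1 ⇑(heckeT (Gamma0 N) k 2 f)).coeff i = 0
    rw [qExpansion_coeff_heckeT_holds N k f 2 Nat.prime_two i, if_pos h2, add_zero]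
    exact h i hi
  exact cuspForm_eq_of_modularForm_eq (hmf.trans (by rfl))

/-- **All even coefficients vanish** under the same hypotheses. [cite: DiamondShurman2005, Prop. 5.2.2(a)] [cite: Sturm1987, Thm. 1] -/
theorem cuspCoeff_even_eq_zero_of_coeff_eq_zero (h2 : 2 ∣ N) (f : CuspForm (Gamma0 N) k) {m : ℕ} (hm : (k * gamma0Index N).toNat / 12 < m)
    (h : ∀ n < m, cuspCoeff f (2 * n) = 0) : ∀ n : ℕ, 2 ∣ n → cuspCoeff f n = 0 := by
  rintro n ⟨j, rfl⟩
  have hT := qExpansion_coeff_heckeT_holds N k f 2 Nat.prime_two j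
  rw [heckeT_two_eq_zero_of_coeff_eq_zero h2 f hm h, if_pos h2, add_zero, CuspForm.coe_zero, UpperHalfPlane.qExpansion_zero] at hT
  change (qExpansion 1 ⇑f).coeff (2 * j) = 0
  rw [← hT]
  simp

/-- **Table form**: an integer table `t` of `aₙ(f)` to depth `K` whose even entries vanish up to `2(m−1) < K`, with `⌊k·μ₀(N)/12⌋ < m`, gives
`a₂ₙ(f) = 0` for every `n` (both table hypotheses are `decide`-able). [cite: Sturm1987, Thm. 1] -/
theorem cuspCoeff_even_eq_zero_of_table (h2 : 2 ∣ N) (f : CuspForm (Gamma0 N) k) {m K : ℕ} (hm : (k * gamma0Index N).toNat / 12 < m)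
    (hK : 2 * m ≤ K + 1) (t : List ℤ) (ht : ∀ n < K, ((t.getD n 0 : ℤ) : ℂ) = cuspCoeff f n) (hz : ∀ n < m, t.getD (2 * n) 0 = 0) :
    ∀ n : ℕ, 2 ∣ n → cuspCoeff f n = 0 :=
  cuspCoeff_even_eq_zero_of_coeff_eq_zero h2 f hm fun n hn ↦ by
    rw [← ht (2 * n) (by omega), hz n hn, Int.cast_zero]

end Summit.BirchSwinnertonDyer.BirchSwinnertonDyer.Theorems.ManinLocalTwoThree.EvenCoeffVanishing

end
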